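import Summits.QuantumFields.YangMills.Theorems.SwapTwistDeficitSmallBallAllL
import Summits.QuantumFields.YangMills.Theorems.SwapTwistDeficitTwistedRingInsertion
import Summits.QuantumFields.YangMills.Theorems.SwapTwistDeficitTwistedRingFarBonds
import Summits.QuantumFields.YangMills.Theorems.SwapTwistDeficitWeakSmallBallDoor
import HarnessLib

/-!
# ★★★ `SwapTwistDeficit.TwistRatioVanishesFixedL` (item stmt-QuantumFields-23802, O1) — PROVED BY NAME:
# at every fixed `L` the swap expectation `Z^S_phys(L,β,2L)/Z_phys(L,β,2L) → 0` as `β → ∞`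

Seat ym-line-fcl-p3 g42 (free hands), LINE g11-A of seat ym-idea-4.  With the small-ball estimate for every `L ≥ 1` (`…SmallBallAllL.smallBall_allL`),
the strip door for the twisted trace (`…TwistedRingFarBonds`), the operator-positivity step `Z^S_A ≤ Z_A` (`…TwistedRingInsertion`) and the explicit floor
(`…SmallBallFloors`), the twist-ratio window holds for EVERY `L ≥ 1`, and O1 follows at each fixed `L` by squeezing:

* §3 `twistRatio_window_of_smallBall_from` — the door of `…TwistRatioWindow` with the `L`-threshold carried EXPLICITLY (`L₀` a parameter);
* §4 ★★ `twistRatio_window_allL` — `∃ a > 0, β₀: ∀ β ≥ β₀, ∀ L ≥ 1 with L ≤ β^a, 0 ≤ Z^S_phys(2L) ≤ β^{−a}·Z_phys(2L)`;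
* §5 ★★★ `twistRatioVanishesFixedL_proof : Summit.QuantumFields.YangMills.Theses.SwapTwistDeficit.TwistRatioVanishesFixedL` — O1 BY NAME (at fixed `L`
  the window condition `L ≤ β^a` holds for `β ≥ L^{1/a}`, and the ratio lies between `0` and `β^{−a} → 0`).

HONEST FRAMING: a support item (O1) of a DRAFT line onto the RECORD rung K2a is closed; the crux `TwistDeficit` ⟨23317⟩ still needs the polynomial tail
⟨23777⟩ and `SubFemtoEntropy` ⟨23272⟩; fixed-lattice ∕ Laplace-window statements only — nothing about infinite volume, the continuum limit or the Clay
gap; the Yang–Mills mass gap is NOT proved.  No `sorry`, no new axiom, no new definition.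
References: [cite: tHooft1979Flux]; [cite: TomboulisYaffe1985]; [cite: Luscher1983, §2]; [cite: MontvayMunster1994, (3.145)]; [cite: SeilerLNP1982, §3].
-/

set_option autoImplicit false

noncomputable section

open MeasureTheory Filter Topology Real Function
open scoped Matrix ComplexConjugate BigOperators
open Literature.MathematicalPhysics.QuantumLattice
open Literature.MathematicalPhysics.QuantumFieldTheory hiding SU2
open Summit.QuantumFields.YangMills.Theorems

namespace Summit.QuantumFields.YangMills.Theorems.SwapTwistDeficit

open Summit.QuantumFields.YangMills.Theorems.FemtoTransferGap
open Summit.QuantumFields.YangMills.Theorems.FemtoTransferGap.TT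
open Summit.QuantumFields.YangMills.Theorems.FemtoTransferGap.FlatSheet

/-! ## §3 The door with an explicit `L`-threshold -/

set_option maxHeartbeats 800000 in
/-- **DOOR with the `L`-threshold carried explicitly** (compare `twistRatio_window_of_smallBall`, where it is existential): for `0 < a ≤ 1`,
`γ < 1/2 − 4a` and ANY `L₀`, (SB) on `{L₀ ≤ L ≤ β^a}` eventually in `β` gives `Z^S_phys(2L) ≤ 2β^{−a}·Z_phys(2L)` on the same set of `L`,
eventually in `β`. [cite: tHooft1979Flux] [cite: SeilerLNP1982, §3] [cite: Luscher1983, §2] -/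
theorem twistRatio_window_of_smallBall_from (L₀ : ℕ) {a γ : ℝ} (ha : 0 < a) (ha1 : a ≤ 1) (hγ : γ < 1 / 2 - 4 * a)
    (hSB : ∃ β₀ : ℝ, ∀ β : ℝ, β₀ ≤ β → ∀ (L : ℕ) [NeZero L], L₀ ≤ L → (L : ℝ) ≤ β ^ a →
      insTrace L β (Set.indicator {U : GaugeConfig 3 L FemtoTransferGap.SU2 |
          |polDist U - polDist (configPerm (Equiv.swap (0 : Fin 3) 1) U)| ≤ β ^ (-γ)} fun _ => (1 : ℝ)) 0 ≤
        β ^ (-a) * physTrace L β (2 * L)) :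
    ∃ β₀ : ℝ, ∀ β : ℝ, β₀ ≤ β → ∀ (L : ℕ) [NeZero L], L₀ ≤ L → (L : ℝ) ≤ β ^ a →
      twistTrace L β (2 * L) ≤ 2 * β ^ (-a) * physTrace L β (2 * L) := by
  obtain ⟨β₀, hSB⟩ := hSB
  obtain ⟨β₁, hβ₁9, hwidth⟩ := stripWidth_antipodal_le_rpow ha1 hγ
  set w₀ : ℝ := Real.exp (-(1 / 2 : ℝ)) * (8 / (3 * π ^ 3)) with hw₀
  refine ⟨max (max β₀ β₁) (4 / w₀), fun β hβ L _ hL hLβ => ?_⟩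
  have hββ₀ : β₀ ≤ β := ((le_max_left _ _).trans (le_max_left _ _)).trans hβ
  have hββ₁ : β₁ ≤ β := ((le_max_right _ _).trans (le_max_left _ _)).trans hβ
  have hβw : 4 / w₀ ≤ β := (le_max_right _ _).trans hβ
  have hβ9 : 9 ≤ β := hβ₁9.trans hββ₁
  have hβ1 : 1 ≤ β := by linarith
  have hβ0 : 0 < β := by linarith
  have hL1 : 1 ≤ L := NeZero.one_le
  set E : ℕ := Fintype.card (Edge 3 L) with hE
  set P : ℕ := Fintype.card (Plaquette 3 L) with hP
  set N : ℕ := 8 * P + 97 * E with hN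
  set M : ℝ := Real.exp (2 * β) ^ E with hM
  set Z : ℝ := physTrace L β (2 * L) with hZ
  set c : ℝ := a + 2 * L * (8 * (P : ℝ) + 97 * (E : ℝ)) + 4 with hc
  set t : ℝ := Real.sqrt (2 * c * Real.log β / β) with ht
  have hM0 : 0 < M := by positivity
  have hZpos : 0 < Z := physTrace_two_mul_pos hL1 hβ1
  have hlog0 : 0 ≤ Real.log β := Real.log_nonneg hβ1
  have hc0 : 0 ≤ c := by rw [hc]; positivity
  have ht0 : 0 ≤ t := Real.sqrt_nonneg _
  have hdoor := twistTrace_le_twistChainStrip_add (L := L) hβ0.le ht0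
  set A : Set (GaugeConfig 3 L FemtoTransferGap.SU2) :=
    {U | |polDist U - polDist (configPerm (Equiv.swap (0 : Fin 3) 1) U)| ≤ 2 * (L : ℝ) * ((L : ℝ) * t)} with hA
  have hAm : MeasurableSet A := measurableSet_strip _
  have hAS : ∀ U, configPerm (Equiv.swap (0 : Fin 3) 1) U ∈ A ↔ U ∈ A := fun U => by
    simp only [hA, Set.mem_setOf_eq]
    rw [configPerm_swap_swap, abs_sub_comm]
  have hwid : 2 * (L : ℝ) * ((L : ℝ) * t) ≤ β ^ (-γ) := by
    have h := hwidth β hββ₁ L hLβ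
    simpa only [ht, hc] using h
  have hAB : A ⊆ {U | |polDist U - polDist (configPerm (Equiv.swap (0 : Fin 3) 1) U)| ≤ β ^ (-γ)} := fun U hU => le_trans hU hwid
  have hstrip : insTrace L β (A.indicator fun _ => (1 : ℝ)) 0 ≤ β ^ (-a) * Z :=
    (insTrace_indicator_zero_mono hβ0.le hAm (measurableSet_strip _) hAB).trans (hSB β hββ₀ L hL hLβ)
  have hpos := twistChainIndicator_le_insTrace (L := L) β hAm hAS
  have hlam : M * (β ^ N)⁻¹ ≤ levelValue su2Rep L β 0 := levelValue_zero_ge_rpow hβ9 hβw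
  have hfloor : (M * (β ^ N)⁻¹) ^ (2 * L) ≤ Z :=
    (pow_le_pow_left₀ (by positivity) hlam _).trans (pow_levelValue_zero_le_physTrace hL1 hβ1)
  have hβt : β * t ^ 2 / 2 = c * Real.log β := by
    have h2 : t ^ 2 = 2 * c * Real.log β / β := by rw [ht, Real.sq_sqrt (by positivity)]
    rw [h2]
    field_simp
  have eExp : Real.exp (-(β * t ^ 2 / 2)) = β ^ (-c) := by
    rw [hβt, Real.rpow_def_of_pos hβ0]; congr 1; ring
  have eM : Real.exp (β * (2 * (E : ℝ) - t ^ 2 / 2)) = M * Real.exp (-(β * t ^ 2 / 2)) := by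
    rw [hM, ← Real.exp_nat_mul, ← Real.exp_add]; congr 1; ring
  have hη : Real.exp (β * (2 * (E : ℝ) - t ^ 2 / 2)) * M ^ (2 * L - 1) = β ^ (-c) * M ^ (2 * L) := by
    rw [eM, eExp]
    have e2 : M ^ (2 * L) = M * M ^ (2 * L - 1) := by
      rw [← pow_succ']; congr 1; omega
    rw [e2]; ring
  have hNc : β ^ (-c) = β ^ (-a) * ((β ^ N) ^ (2 * L))⁻¹ * β ^ (-(4 : ℝ)) := by
    rw [hc, show -(a + 2 * L * (8 * (P : ℝ) + 97 * (E : ℝ)) + 4) = -a + -(((2 * L * N : ℕ) : ℝ)) + -(4 : ℝ) by rw [hN]; push_cast; ring,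
      Real.rpow_add hβ0, Real.rpow_add hβ0, Real.rpow_neg hβ0.le (((2 * L * N : ℕ) : ℝ)), Real.rpow_natCast, mul_comm (2 * L) N, pow_mul]
  have hβ4 : β ^ (-(4 : ℝ)) ≤ 1 / 8 := by
    rw [Real.rpow_neg hβ0.le, show (4 : ℝ) = ((4 : ℕ) : ℝ) by norm_num, Real.rpow_natCast, inv_eq_one_div]
    have h8 : (8 : ℝ) ≤ β ^ 4 := by
      have h2 : (2 : ℝ) ≤ β := by linarith
      calc (8 : ℝ) ≤ 2 ^ 4 := by norm_num
        _ ≤ β ^ 4 := pow_le_pow_left₀ (by norm_num) h2 4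
    exact div_le_div_of_nonneg_left zero_le_one (by norm_num) h8
  have hfar : Real.exp (β * (2 * (E : ℝ) - t ^ 2 / 2)) * M ^ (2 * L - 1) ≤ β ^ (-a) / 8 * Z := by
    rw [hη, hNc]
    have hpos1 : 0 ≤ β ^ (-a) := Real.rpow_nonneg hβ0.le _
    have hkey : ((β ^ N) ^ (2 * L))⁻¹ * M ^ (2 * L) ≤ Z := by
      rw [← inv_pow, ← mul_pow, mul_comm]; exact hfloor
    calc β ^ (-a) * ((β ^ N) ^ (2 * L))⁻¹ * β ^ (-(4 : ℝ)) * M ^ (2 * L)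
        = β ^ (-a) * β ^ (-(4 : ℝ)) * (((β ^ N) ^ (2 * L))⁻¹ * M ^ (2 * L)) := by ring
      _ ≤ β ^ (-a) * (1 / 8) * Z := mul_le_mul (mul_le_mul_of_nonneg_left hβ4 hpos1) hkey (by positivity) (by positivity)
      _ = β ^ (-a) / 8 * Z := by ring
  have hZS : twistTrace L β (2 * L) ≤ β ^ (-a) * Z + β ^ (-a) / 8 * Z := by
    linarith [hdoor, hpos, hstrip, hfar]
  have hpos2 : 0 ≤ β ^ (-a) * Z := mul_nonneg (Real.rpow_nonneg hβ0.le _) hZpos.le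
  calc twistTrace L β (2 * L) ≤ β ^ (-a) * Z + β ^ (-a) / 8 * Z := hZS
    _ ≤ 2 * β ^ (-a) * Z := by nlinarith [hpos2]

/-! ## §4 ★★ The twist-ratio window for every `L ≥ 1` -/

/-- ★★ **THE TWIST-RATIO WINDOW FOR EVERY `L ≥ 1`.**  There are `a > 0` and `β₀` such that for all `β ≥ β₀` and EVERY `L ≥ 1` with `L ≤ β^a`:
`0 ≤ Z^S_phys(L, β, 2L) ≤ β^{−a}·Z_phys(L, β, 2L)`.  (§3 with `L₀ = 1` over §2, exponent halved.) [cite: tHooft1979Flux] [cite: TomboulisYaffe1985]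
[cite: Luscher1983, §2] -/
theorem twistRatio_window_allL :
    ∃ a : ℝ, 0 < a ∧ ∃ β₀ : ℝ, ∀ β : ℝ, β₀ ≤ β → ∀ (L : ℕ) [NeZero L], (L : ℝ) ≤ β ^ a →
      0 ≤ twistTrace L β (2 * L) ∧ twistTrace L β (2 * L) ≤ β ^ (-a) * physTrace L β (2 * L) := by
  obtain ⟨a, ha, ha1, γ, hγ, β₀, hSB⟩ := smallBall_allL
  obtain ⟨β₀', hW⟩ := twistRatio_window_of_smallBall_from 1 ha ha1 hγ ⟨β₀, fun β hβ L _ _ hLβ => hSB β hβ L hLβ⟩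
  refine ⟨a / 2, by positivity, max (max β₀' 1) ((2 : ℝ) ^ (2 / a)), fun β hβ L _ hLβ => ?_⟩
  have hββ₀ : β₀' ≤ β := ((le_max_left _ _).trans (le_max_left _ _)).trans hβ
  have hβ1 : 1 ≤ β := ((le_max_right _ _).trans (le_max_left _ _)).trans hβ
  have hβ2 : (2 : ℝ) ^ (2 / a) ≤ β := (le_max_right _ _).trans hβ
  have hβ0 : 0 < β := by linarith
  have hL1 : 1 ≤ L := NeZero.one_le
  have hLβa : (L : ℝ) ≤ β ^ a := hLβ.trans (Real.rpow_le_rpow_of_exponent_le hβ1 (by linarith))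
  have hZpos : 0 < physTrace L β (2 * L) := physTrace_two_mul_pos hL1 hβ1
  have hmain := hW β hββ₀ L hL1 hLβa
  have h2le : (2 : ℝ) ≤ β ^ (a / 2) := by
    have h := Real.rpow_le_rpow (by positivity) hβ2 (by positivity : (0 : ℝ) ≤ a / 2)
    rwa [← Real.rpow_mul (by norm_num), show 2 / a * (a / 2) = 1 by field_simp, Real.rpow_one] at h
  have hkey : 2 * β ^ (-a) ≤ β ^ (-(a / 2)) := by
    have e1 : β ^ (-(a / 2)) = β ^ (-a) * β ^ (a / 2) := by
      rw [← Real.rpow_add hβ0]; congr 1; ring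
    have hpos : 0 ≤ β ^ (-a) := Real.rpow_nonneg hβ0.le _
    calc 2 * β ^ (-a) = β ^ (-a) * 2 := mul_comm _ _
      _ ≤ β ^ (-a) * β ^ (a / 2) := mul_le_mul_of_nonneg_left h2le hpos
      _ = β ^ (-(a / 2)) := e1.symm
  exact ⟨twistTrace_two_mul_nonneg β, hmain.trans (mul_le_mul_of_nonneg_right hkey hZpos.le)⟩

/-! ## §5 ★★★ O1 by name -/

/-- ★★★ **`SwapTwistDeficit.TwistRatioVanishesFixedL` holds** (item stmt-QuantumFields-23802, O1 of LINE g11-A, BY NAME): at every fixed `L ≥ 2` (indeed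
every `L ≥ 1`) the swap expectation `⟨S⟩_β = Z^S_phys(L,β,2L)/Z_phys(L,β,2L) → 0` as `β → ∞` — at fixed `L` the window condition `L ≤ β^a` of §4 holds for
`β ≥ L^{1/a}`, and the ratio is squeezed between `0` and `β^{−a} → 0`.  The YM mass gap is NOT proved. [cite: tHooft1979Flux] [cite: Luscher1983, §2] -/
theorem twistRatioVanishesFixedL_proof : Summit.QuantumFields.YangMills.Theses.SwapTwistDeficit.TwistRatioVanishesFixedL := by
  intro L _ _
  obtain ⟨a, ha, β₀, h⟩ := twistRatio_window_allL
  have hL1 : 1 ≤ L := NeZero.one_le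
  have hL0 : (0 : ℝ) < L := by exact_mod_cast (show 0 < L by omega)
  have hev : ∀ᶠ β : ℝ in atTop, 0 ≤ twistTrace L β (2 * L) / physTrace L β (2 * L) ∧
      twistTrace L β (2 * L) / physTrace L β (2 * L) ≤ β ^ (-a) := by
    filter_upwards [eventually_ge_atTop β₀, eventually_ge_atTop (1 : ℝ), eventually_ge_atTop ((L : ℝ) ^ (1 / a))] with β hβ hβ1 hβL
    have hLβ : (L : ℝ) ≤ β ^ a := by
      have h1 := Real.rpow_le_rpow (Real.rpow_nonneg hL0.le _) hβL ha.le
      rwa [← Real.rpow_mul hL0.le, show 1 / a * a = 1 by field_simp, Real.rpow_one] at h1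
    have hZpos : 0 < physTrace L β (2 * L) := physTrace_two_mul_pos hL1 hβ1
    obtain ⟨h0, h1⟩ := h β hβ L hLβ
    exact ⟨div_nonneg h0 hZpos.le, (div_le_iff₀ hZpos).2 h1⟩
  refine tendsto_of_tendsto_of_tendsto_of_le_of_le' tendsto_const_nhds (tendsto_rpow_neg_atTop ha) ?_ ?_
  · exact hev.mono fun β hβ => hβ.1
  · exact hev.mono fun β hβ => hβ.2

end Summit.QuantumFields.YangMills.Theorems.SwapTwistDeficit

end
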